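import Summits.MatrixMultiplication.OmegaCensus.STPP222IcosetWSearchTriples
import Summits.MatrixMultiplication.OmegaCensus.STPP222IcosetWSearchLinear

/-!
# ω-census, icoset class negatives at 2-rank four: semantics of the witness-model engine, IV (selection, candidates, refresh)

HONEST FRAMING (pub-omega census; verbatim): lottery ticket; floor = certified bounds/negative ranges.
Census STRUCTURE bookkeeping (Q7, the involution-coset class), nothing about `ω`.

Part IV of the semantics of `STPP222IcosetWSearch.lean`: `select` on a non-empty zero list returns the encoding
`popc16 cm · 2²⁸ + z · 2¹⁶ + cm` of one of its zeros `z` with `cm = candM TI z` (`select_spec`, `encS_fields`); the SEARCH INVARIANT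
`BSol.Inv` of a state relative to a true bit solution `S` (recorded `ψ`'s are `0` or true, recorded points lie on the true lines, every
summary admits the true `ψ` and the true lines, stored rows are satisfied, remaining zeros are rescued); the true witness of a rescued
zero is a candidate (`mem_candM`); and `refresh` along the truth never prunes and re-establishes the summary invariant (`refresh_sound`).
Part V (the child, the search, the root — `vrefute_sound`): `STPP222IcosetWSearchSound.lean`.
Seat pub-omega-kernel-l4 (gen 20), 2026-08-27.
-/

namespace Summit.MatrixMultiplication.OmegaCensus

namespace IcosetW

open IcosetH (getI snoc allN allN_true getI_eq_getD)

/-! ## `popc16` bound and `select` -/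

/-- Kernel evaluation: `popc4 v ≤ 4` for `v < 16`. -/
theorem popc4_check : (allN 16 fun v => Nat.ble (popc4 v) 4) = true := by decide +kernel

/-- `popc16 m ≤ 16`. -/
theorem popc16_le (m : ℕ) : popc16 m ≤ 16 := by
  have h : ∀ v, v < 16 → popc4 v ≤ 4 := fun v hv => Nat.le_of_ble_eq_true (allN_true popc4_check hv)
  unfold popc16
  have h1 := h (Nat.mod m 16) (Nat.mod_lt _ (by norm_num))
  have h2 := h (Nat.mod (Nat.div m 16) 16) (Nat.mod_lt _ (by norm_num))
  have h3 := h (Nat.mod (Nat.div m 256) 16) (Nat.mod_lt _ (by norm_num))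
  have h4 := h (Nat.mod (Nat.div m 4096) 16) (Nat.mod_lt _ (by norm_num))
  show popc4 _ + popc4 _ + (popc4 _ + popc4 _) ≤ 16
  omega

/-- `candM TI z < 2¹⁶`. -/
theorem candM_lt (TI : List ℕ) (z : ℕ) : candM TI z < 65536 := by
  unfold candM; simp only [frc_eq, cnd_eq_ite]
  have hm : Nat.land (Nat.land (tiM0 (getI TI (zi z))) (tiM1 (getI TI (zj z)))) (tiM2 (getI TI (zk z))) < 65536 :=
    lt_of_le_of_lt Nat.and_le_left (lt_of_le_of_lt Nat.and_le_left (Nat.mod_lt _ (by norm_num)))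
  split_ifs
  · exact hm
  · exact lt_of_le_of_lt Nat.and_le_left hm

/-- The encoding produced by `select` for the zero `z`. -/
noncomputable def encS (TI : List ℕ) (z : ℕ) : ℕ :=
  Nat.add (Nat.add (Nat.mul (popc16 (candM TI z)) 268435456) (Nat.mul z 65536)) (candM TI z)

/-- The fold inside `select`. -/
noncomputable def selRec (TI : List ℕ) (TD : List ℕ) (best : ℕ) : ℕ :=
  @List.rec ℕ (fun _ => ℕ → ℕ) (fun best => best)
    (fun z _ ih best => frc (candM TI z) fun cm => frc (popc16 cm) fun c =>
      frc (cnd (Nat.blt c (Nat.div best 268435456)) (Nat.add (Nat.add (Nat.mul c 268435456) (Nat.mul z 65536)) cm) best)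
        fun best' => ih best') TD best

/-- `select` is `selRec` from the initial value. -/
theorem select_eq (TI TD : List ℕ) : select TI TD = selRec TI TD 4563402752 := rfl

/-- One step of `selRec`. -/
theorem selRec_cons (TI : List ℕ) (z : ℕ) (TD : List ℕ) (best : ℕ) : selRec TI (z :: TD) best =
    selRec TI TD (cnd (Nat.blt (popc16 (candM TI z)) (Nat.div best 268435456)) (encS TI z) best) := by
  show frc (candM TI z) (fun cm => frc (popc16 cm) fun c => frc (cnd (Nat.blt c (Nat.div best 268435456))
    (Nat.add (Nat.add (Nat.mul c 268435456) (Nat.mul z 65536)) cm) best) fun best' => selRec TI TD best') = _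
  simp only [frc_eq]; rfl

/-- The fold returns the start value or the encoding of a member. -/
theorem selRec_mem (TI : List ℕ) : ∀ (TD : List ℕ) (best : ℕ),
    selRec TI TD best = best ∨ ∃ z ∈ TD, selRec TI TD best = encS TI z := by
  intro TD
  induction TD with
  | nil => intro best; exact Or.inl rfl
  | cons z TD ih =>
    intro best
    rw [selRec_cons, cnd_eq_ite]
    split_ifs
    · rcases ih (encS TI z) with h | ⟨z', hz', h⟩
      · exact Or.inr ⟨z, List.mem_cons_self, h⟩
      · exact Or.inr ⟨z', List.mem_cons_of_mem _ hz', h⟩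
    · rcases ih best with h | ⟨z', hz', h⟩
      · exact Or.inl h
      · exact Or.inr ⟨z', List.mem_cons_of_mem _ hz', h⟩

/-- **`select` on a non-empty list returns the encoding of one of its zeros.** -/
theorem select_spec (TI : List ℕ) (z₀ : ℕ) (TD : List ℕ) : ∃ z ∈ z₀ :: TD, select TI (z₀ :: TD) = encS TI z := by
  rw [select_eq, selRec_cons]
  have hlt : Nat.blt (popc16 (candM TI z₀)) (Nat.div 4563402752 268435456) = true := by
    rw [Nat.blt_eq]; exact lt_of_le_of_lt (popc16_le _) (by show (16 : ℕ) < 17; norm_num)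
  rw [hlt, cnd_true]
  rcases selRec_mem TI TD (encS TI z₀) with h | ⟨z, hz, h⟩
  · exact ⟨z₀, List.mem_cons_self, h⟩
  · exact ⟨z, List.mem_cons_of_mem _ hz, h⟩

/-- Decoding the three fields of `encS` (`z < 4096`). -/
theorem encS_fields (TI : List ℕ) {z : ℕ} (hz : z < 4096) :
    Nat.div (encS TI z) 268435456 = popc16 (candM TI z) ∧ Nat.mod (Nat.div (encS TI z) 65536) 4096 = z ∧
      Nat.mod (encS TI z) 65536 = candM TI z := by
  have h1 := candM_lt TI z; have h2 := popc16_le (candM TI z)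
  refine ⟨?_, ?_, ?_⟩
  · show (popc16 (candM TI z) * 268435456 + z * 65536 + candM TI z) / 268435456 = _; omega
  · show (popc16 (candM TI z) * 268435456 + z * 65536 + candM TI z) / 65536 % 4096 = z; omega
  · show (popc16 (candM TI z) * 268435456 + z * 65536 + candM TI z) % 65536 = _; omega

/-! ## Bit solutions: lines, rescue, the invariant -/

namespace BSol

variable (S : BSol)

/-- Every frame below `K` is a 4-bit independent frame and the offsets are 4-bit. -/
def FramesOk (K : ℕ) : Prop :=
  ∀ t, t < K → S.sA t < 16 ∧ S.sB t < 16 ∧ S.sC t < 16 ∧ S.p t < 16 ∧ S.q t < 16 ∧ indepB (S.sA t) (S.sB t) (S.sC t) = true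

/-- The point of triple `t`. -/
noncomputable def ψ (t : ℕ) : ℕ := psiB (S.sA t) (S.sB t) (S.sC t)

/-- `u` on line `X` of triple `t`. -/
noncomputable def onL (X t u : ℕ) : Bool := onLB X (S.sA t) (S.sB t) (S.sC t) u

/-- The zero `z = (i, j, k)` is RESCUED: a witness on lines `0/1/2` of `i/j/k` with `u(off) = 1`. -/
def Resc (z : ℕ) : Prop :=
  ∃ u, u < 16 ∧ S.onL 0 (zi z) u = true ∧ S.onL 1 (zj z) u = true ∧ S.onL 2 (zk z) u = true ∧
    ev u (S.off (zi z) (zj z) (zk z)) = true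

/-- THE SEARCH INVARIANT relative to the truth `S`. -/
structure Inv (K : ℕ) (PS PL TI RW TD : List ℕ) : Prop where
  /-- length of `PS` -/ lenPS : PS.length = K
  /-- length of `PL` -/ lenPL : PL.length = 3 * K
  /-- length of `TI` -/ lenTI : TI.length = K
  /-- recorded `ψ` are `0` or true -/ psi : ∀ t, t < K → getI PS t = 0 ∨ getI PS t = S.ψ t
  /-- recorded points lie on the true lines -/
  lines : ∀ t, t < K → ∀ X, X < 3 → OnLine X (S.sA t) (S.sB t) (S.sC t) (getI PL (3 * t + X))
  /-- the true `ψ` is feasible -/ feas : ∀ t, t < K → Mem (tiF (getI TI t)) (S.ψ t)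
  /-- the true lines are admissible -/
  adm : ∀ t, t < K → ∀ u, u < 16 → (S.onL 0 t u = true → Mem (tiM0 (getI TI t)) u) ∧
    (S.onL 1 t u = true → Mem (tiM1 (getI TI t)) u) ∧ (S.onL 2 t u = true → Mem (tiM2 (getI TI t)) u)
  /-- stored rows are satisfied -/ rows : ∀ x ∈ RW, S.rowVal (8 * K) x = false ∧ x < 2 ^ (8 * K + 1)
  /-- remaining zeros are in range and rescued -/ zeros : ∀ z ∈ TD, zi z < K ∧ zj z < K ∧ zk z < K ∧ S.Resc z

variable {S}

/-- A witness on two lines of one triple is the triple's point. -/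
theorem eq_ψ_of_two_lines {K t u : ℕ} (hF : S.FramesOk K) (ht : t < K) (hu : u < 16) {X Y : ℕ} (hXY : X ≠ Y) (hX : X < 3)
    (hY : Y < 3) (h1 : S.onL X t u = true) (h2 : S.onL Y t u = true) : u = S.ψ t := by
  obtain ⟨ha, hb, hc, -, -, hi⟩ := hF t ht
  unfold onL onLB at h1 h2
  simp only [cnd_eq_ite, Nat.beq_eq, Bool.and_eq_true, Bool.not_eq_true'] at h1 h2
  have h0 : u ≠ 0 := Nat.ne_of_beq_eq_false h1.1
  have key : kills u (S.sA t) = true ∧ kills u (S.sB t) = true ∧ kills u (S.sC t) = true := by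
    interval_cases X <;> interval_cases Y <;> simp_all
  exact eq_psiB_of_kills ha hb hc hi hu h0 key.1 key.2.1 key.2.2

/-- The three shapes of `zrep`. -/
theorem zrep_cases (z : ℕ) : zrep z = 0 ∨ (zj z = zk z ∧ zrep z = zj z + 1) ∨
    (zj z ≠ zk z ∧ (zi z = zj z ∨ zi z = zk z) ∧ zrep z = zi z + 1) := by
  unfold zrep; simp only [cnd_eq_ite, Nat.beq_eq, Bool.or_eq_true]
  by_cases hjk : zj z = zk z
  · exact Or.inr (Or.inl ⟨hjk, by rw [if_pos hjk]⟩)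
  · by_cases hij : zi z = zj z ∨ zi z = zk z
    · exact Or.inr (Or.inr ⟨hjk, hij, by rw [if_neg hjk, if_pos hij]⟩)
    · exact Or.inl (by rw [if_neg hjk, if_neg hij])

/-- `candM` unfolded. -/
theorem candM_eq (TI : List ℕ) (z : ℕ) : candM TI z =
    cnd (Nat.beq (zrep z) 0) (Nat.land (Nat.land (tiM0 (getI TI (zi z))) (tiM1 (getI TI (zj z)))) (tiM2 (getI TI (zk z))))
      (Nat.land (Nat.land (Nat.land (tiM0 (getI TI (zi z))) (tiM1 (getI TI (zj z)))) (tiM2 (getI TI (zk z))))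
        (tiF (getI TI (Nat.sub (zrep z) 1)))) := by
  unfold candM; simp only [frc_eq]

/-- **The true witness is a candidate.** -/
theorem mem_candM {K : ℕ} {PS PL TI RW TD : List ℕ} (hF : S.FramesOk K) (I : S.Inv K PS PL TI RW TD) {z u : ℕ}
    (hi : zi z < K) (hj : zj z < K) (hk : zk z < K) (hu : u < 16) (h0 : S.onL 0 (zi z) u = true)
    (h1 : S.onL 1 (zj z) u = true) (h2 : S.onL 2 (zk z) u = true) : Mem (candM TI z) u := by
  have hm : Mem (Nat.land (Nat.land (tiM0 (getI TI (zi z))) (tiM1 (getI TI (zj z)))) (tiM2 (getI TI (zk z)))) u :=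
    mem_land.2 ⟨mem_land.2 ⟨(I.adm _ hi u hu).1 h0, (I.adm _ hj u hu).2.1 h1⟩, (I.adm _ hk u hu).2.2 h2⟩
  rw [candM_eq]
  rcases zrep_cases z with h | ⟨hjk, h⟩ | ⟨-, hij, h⟩
  · rw [h]; exact hm
  · rw [h]
    show Mem (Nat.land _ (tiF (getI TI (zj z)))) u
    refine mem_land.2 ⟨hm, ?_⟩
    rw [eq_ψ_of_two_lines hF hj hu (by norm_num) (by norm_num) (by norm_num) h1 (hjk ▸ h2)]; exact I.feas _ hj
  · rw [h]
    show Mem (Nat.land _ (tiF (getI TI (zi z)))) u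
    refine mem_land.2 ⟨hm, ?_⟩
    have e : u = S.ψ (zi z) := by
      rcases hij with hij | hik
      · exact eq_ψ_of_two_lines hF hi hu (by norm_num) (by norm_num) (by norm_num) h0 (hij ▸ h1)
      · exact eq_ψ_of_two_lines hF hi hu (by norm_num) (by norm_num) (by norm_num) h0 (hik ▸ h2)
    rw [e]; exact I.feas _ hi

/-! ## `refresh` and the child along the truth -/

/-- `refresh` unfolded. -/
theorem refresh_eq (PS PL TI : List ℕ) (t : ℕ) (k : List ℕ → List ℕ → Bool) :
    refresh PS PL TI t k =
      cnd (Nat.beq (tripInfo (getI PS t) (getI PL (Nat.mul 3 t)) (getI PL (Nat.add (Nat.mul 3 t) 1))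
        (getI PL (Nat.add (Nat.mul 3 t) 2))) 0) true
        (k (setI PS t (tiPsi (tripInfo (getI PS t) (getI PL (Nat.mul 3 t)) (getI PL (Nat.add (Nat.mul 3 t) 1))
          (getI PL (Nat.add (Nat.mul 3 t) 2)))))
          (setI TI t (tripInfo (getI PS t) (getI PL (Nat.mul 3 t)) (getI PL (Nat.add (Nat.mul 3 t) 1))
            (getI PL (Nat.add (Nat.mul 3 t) 2))))) := by
  unfold refresh; simp only [frc_eq, frcL_eq]

/-- The invariant restricted to `(PS, PL, TI)` (what `refresh` touches), with the summaries required only on a set `D` of triples. -/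
structure InvT (K : ℕ) (D : ℕ → Prop) (PS PL TI : List ℕ) : Prop where
  /-- length of `PS` -/ lenPS : PS.length = K
  /-- length of `PL` -/ lenPL : PL.length = 3 * K
  /-- length of `TI` -/ lenTI : TI.length = K
  /-- recorded `ψ` -/ psi : ∀ t, t < K → getI PS t = 0 ∨ getI PS t = S.ψ t
  /-- recorded points -/ lines : ∀ t, t < K → ∀ X, X < 3 → OnLine X (S.sA t) (S.sB t) (S.sC t) (getI PL (3 * t + X))
  /-- feasibility on `D` -/ feas : ∀ t, t < K → D t → Mem (tiF (getI TI t)) (S.ψ t)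
  /-- admissibility on `D` -/
  adm : ∀ t, t < K → D t → ∀ u, u < 16 → (S.onL 0 t u = true → Mem (tiM0 (getI TI t)) u) ∧
    (S.onL 1 t u = true → Mem (tiM1 (getI TI t)) u) ∧ (S.onL 2 t u = true → Mem (tiM2 (getI TI t)) u)

/-- **`refresh` along the truth**: it continues (never prunes) with a state satisfying the invariant on `D ∪ {t}`. -/
theorem refresh_sound {K : ℕ} (hF : S.FramesOk K) {D : ℕ → Prop} {PS PL TI : List ℕ} (I : S.InvT K D PS PL TI) {t : ℕ}
    (ht : t < K) (k : List ℕ → List ℕ → Bool) :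
    ∃ PS' TI', refresh PS PL TI t k = k PS' TI' ∧ S.InvT K (fun s => D s ∨ s = t) PS' PL TI' := by
  obtain ⟨ha, hb, hc, -, -, hi⟩ := hF t ht
  have hl0 := I.lines t ht 0 (by norm_num); have hl1 := I.lines t ht 1 (by norm_num); have hl2 := I.lines t ht 2 (by norm_num)
  rw [Nat.add_zero] at hl0
  obtain ⟨hr0, hψ', hfeas, hadm⟩ := tripInfo_sound ha hb hc hi (I.psi t ht) hl0 hl1 hl2
  set r := tripInfo (getI PS t) (getI PL (3 * t)) (getI PL (3 * t + 1)) (getI PL (3 * t + 2)) with hr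
  refine ⟨setI PS t (tiPsi r), setI TI t r, ?_, ?_⟩
  · rw [refresh_eq]
    show cnd (Nat.beq r 0) true (k (setI PS t (tiPsi r)) (setI TI t r)) = _
    rw [beq_false_of_ne hr0, cnd_false]
  · have hPS : t < PS.length := by rw [I.lenPS]; exact ht
    have hTI : t < TI.length := by rw [I.lenTI]; exact ht
    refine ⟨by rw [length_setI, I.lenPS], I.lenPL, by rw [length_setI, I.lenTI], fun s hs => ?_, I.lines, fun s hs hD => ?_,
      fun s hs hD u hu => ?_⟩
    · rw [getI_setI _ _ _ _ hPS]; split_ifs with h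
      · subst h; exact hψ'
      · exact I.psi s hs
    · rw [getI_setI _ _ _ _ hTI]; split_ifs with h
      · subst h; exact hfeas
      · exact I.feas s hs (hD.resolve_right h)
    · rw [getI_setI _ _ _ _ hTI]; split_ifs with h
      · subst h; exact hadm u hu
      · exact I.adm s hs (hD.resolve_right h) u hu

end BSol

end IcosetW

end Summit.MatrixMultiplication.OmegaCensus
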